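import Summits.Ventures.QEDPrecision.BubbleChains.DoubleBubbleReduction
import Literature.MathematicalPhysics.QuantumFieldTheory.KaptariLashkevichSolovtsova2025.SixthOrderVPInsertions

/-!
# Sixth-order double bubble, II: `vpChain 2 1 = −943/324 − 4π²/135 + (8/3) ζ(3)` (kernel theorem)

HONEST FRAMING: independent recomputation; certified where stated, statistical where stated; no new-physics claim.

Cell `pub-qed`, unit `pub-qed-lit`. MAIN RESULT `vpChain_two_one : vpChain 2 1 = vp6DoubleBubble`: the equal-mass
two-insertion coefficient of Jegerlehner's sequential-insertion representation [cite: Jegerlehner2017, eq. (3.153)],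
`∫₀¹ (1−x) (−Π₂(s_x))² dx` (`Jegerlehner2017.vpChain 2 1`), equals the printed closed form
`−943/324 − 4π²/135 + (8/3)ζ(3)` [cite: SolovtsovaLashkevichKaptari2022, eq. (lim1)] (orig. Mignaco–Remiddi 1969),
typed in the tree as `KaptariLashkevichSolovtsova2025.vp6DoubleBubble`. The published derivations use dispersion
relations / Mellin–Barnes representations; this formalisation takes an elementary road (Route D of the cell):
stage 4 (`elem_pow2_identity`, `tendsto_elem_pow2`): the elementary part of the exact reduction
(`DoubleBubbleReduction.lean`) tends to `−347/162` as `ε → 0⁺` — the poles `ε^{−j}` cancel against the Taylor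
polynomial of `log(1−ε)`, the remainder is controlled by `Real.abs_log_sub_add_sum_range_le`; stage 5
(`vpChain_2_one_eq`): `ε → 0⁺` in the reduction (`tendsto_integral_left`, uniqueness of limits), then the six kept
masters take their values from `LogPowerIntegrals.lean` (`ζ(2) = π²/6` is `LaportaRemiddi1996.zeta_two`).
For n = 2 this removes the qualifier 'closed form taken from print, not Lean-proved' on the cell's bubble-chain
comparisons (`Certificates/UniversalBubbleChainEnclosures.lean`); n = 3 (`a8GroupIaClosedForm`) and n = 4
(`a1TenSetIaClosedForm`) are the same road with masters up to `log⁴`. No definitions; zero `kit` compute.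
-/

noncomputable section

open Real Set MeasureTheory intervalIntegral Filter Topology

namespace Summit.Ventures.QEDPrecision.BubbleChains

open Literature.MathematicalPhysics.QuantumFieldTheory.Jegerlehner2017
  (piOneLoop sX vpChain neg_piOneLoop_sX_eq neg_piOneLoop_sX_bounds
      vpChain_one_eq_integral_closedKernel)
open Literature.MathematicalPhysics.QuantumFieldTheory.LaportaRemiddi1996 (zeta zeta_two)
open Literature.MathematicalPhysics.QuantumFieldTheory.KaptariLashkevichSolovtsova2025
    (vp6DoubleBubble)

/-! ## Stage 4: the elementary part and its limit -/

/-- The elementary part of the reduction as a function of `ε` and of `Λ` (`= log (1−ε)`),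
re-expanded around `Λ = ρ − T(ε)`, `T` the degree-6 Taylor polynomial of `−log (1−ε)`,
`ρ = Λ + T(ε)`: all poles cancel (`P(ε)`, `M(ε,ρ)` explicit polynomials, `M` in Horner form in `ρ`).
[folklore] -/
theorem elem_pow2_identity {ε : ℝ} (hε : ε ≠ 0) (Λ : ℝ) :
    ((-311/162 : ℝ)
        + (16/45 : ℝ) * ((ε ^ 5)⁻¹ * Λ ^ 2)
        + (32/45 : ℝ) * ((ε ^ 4)⁻¹ * Λ)
        + (-16/9 : ℝ) * ((ε ^ 4)⁻¹ * Λ ^ 2)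
        + (16/45 : ℝ) * ((ε ^ 3)⁻¹)
        + (-16/5 : ℝ) * ((ε ^ 3)⁻¹ * Λ)
        + (28/9 : ℝ) * ((ε ^ 3)⁻¹ * Λ ^ 2)
        + (-64/45 : ℝ) * ((ε ^ 2)⁻¹)
        + (632/135 : ℝ) * ((ε ^ 2)⁻¹ * Λ)
        + (-14/9 : ℝ) * ((ε ^ 2)⁻¹ * Λ ^ 2)
        + (224/135 : ℝ) * (ε⁻¹)
        + (-136/135 : ℝ) * (ε⁻¹ * Λ)
        + (-20/9 : ℝ) * (ε⁻¹ * Λ ^ 2)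
        + (-32/27 : ℝ) * (Λ)
        + (94/45 : ℝ) * (Λ ^ 2)
        + (95/81 : ℝ) * (ε)
        + (25/162 : ℝ) * (ε ^ 2))
      = (-347/162 : ℝ) + ε * (((-8/45 : ℝ) + (49/135 : ℝ) * ε + (34/135 : ℝ) * ε ^ 2 + (83/405 : ℝ)
          * ε ^ 3 + (6551/40500 : ℝ) * ε ^ 4 + (2093/16200 : ℝ) * ε ^ 5 + (181/300 : ℝ) * ε ^ 6 +
          (1373/5400 : ℝ) * ε ^ 7)
          + ((101/675 : ℝ) * ε ^ 8 + (671/10125 : ℝ) * ε ^ 9 + (157/2025 : ℝ) * ε ^ 10 + (47/810 :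
              ℝ) * ε ^ 11))
        + (Λ + (ε + ε ^ 2 / 2 + ε ^ 3 / 3 + ε ^ 4 / 4 + ε ^ 5 / 5 + ε ^ 6 / 6)) / ε ^ 5 *
            (((2354/675 : ℝ) * ε ^ 5 + (-254/135 : ℝ) * ε ^ 6 + (-13/27 : ℝ) * ε ^ 7 + (-94/135 :
            ℝ) * ε ^ 8 + (49/135 : ℝ) * ε ^ 9 + (-64/675 : ℝ) * ε ^ 10 + (-94/135 : ℝ) * ε ^ 11)
          + (Λ + (ε + ε ^ 2 / 2 + ε ^ 3 / 3 + ε ^ 4 / 4 + ε ^ 5 / 5 + ε ^ 6 / 6)) * ((16/45 : ℝ) +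
              (-16/9 : ℝ) * ε + (28/9 : ℝ) * ε ^ 2 + (-14/9 : ℝ) * ε ^ 3 + (-20/9 : ℝ) * ε ^ 4 +
              (94/45 : ℝ) * ε ^ 5)) := by
  field_simp
  ring

/-- **The elementary part tends to `-347/162`** as `ε → 0⁺` (log series with remainder
`|log(1−ε) + T(ε)| ≤ ε^7/(1−ε)`). [folklore] -/
theorem tendsto_elem_pow2 :
    Tendsto (fun ε : ℝ => ((-311/162 : ℝ)
        + (16/45 : ℝ) * ((ε ^ 5)⁻¹ * log (1 - ε) ^ 2)
        + (32/45 : ℝ) * ((ε ^ 4)⁻¹ * log (1 - ε))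
        + (-16/9 : ℝ) * ((ε ^ 4)⁻¹ * log (1 - ε) ^ 2)
        + (16/45 : ℝ) * ((ε ^ 3)⁻¹)
        + (-16/5 : ℝ) * ((ε ^ 3)⁻¹ * log (1 - ε))
        + (28/9 : ℝ) * ((ε ^ 3)⁻¹ * log (1 - ε) ^ 2)
        + (-64/45 : ℝ) * ((ε ^ 2)⁻¹)
        + (632/135 : ℝ) * ((ε ^ 2)⁻¹ * log (1 - ε))
        + (-14/9 : ℝ) * ((ε ^ 2)⁻¹ * log (1 - ε) ^ 2)
        + (224/135 : ℝ) * (ε⁻¹)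
        + (-136/135 : ℝ) * (ε⁻¹ * log (1 - ε))
        + (-20/9 : ℝ) * (ε⁻¹ * log (1 - ε) ^ 2)
        + (-32/27 : ℝ) * (log (1 - ε))
        + (94/45 : ℝ) * (log (1 - ε) ^ 2)
        + (95/81 : ℝ) * (ε)
        + (25/162 : ℝ) * (ε ^ 2))) (𝓝[>] 0) (𝓝 (-347/162 : ℝ)) := by
  -- the log remainder ρ(ε) = log(1-ε) + T(ε)
  have hρ_bound : ∀ ε : ℝ, 0 < ε → ε < 1/2 → |log (1 - ε) + (ε + ε ^ 2 / 2 + ε ^ 3 / 3 + ε ^ 4 / 4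
      + ε ^ 5 / 5 + ε ^ 6 / 6)| ≤ 2 * ε ^ 7 := by
    intro ε h0 h1
    have habs : |ε| < 1 := by rw [abs_of_pos h0]; linarith
    have h := Real.abs_log_sub_add_sum_range_le habs 6
    simp only [Finset.sum_range_succ, Finset.sum_range_zero, zero_add, pow_one, Nat.cast_zero,
      Nat.cast_one, Nat.cast_ofNat, div_one] at h
    norm_num at h
    rw [abs_of_pos h0] at h
    have h2 : ε ^ 7 / (1 - ε) ≤ 2 * ε ^ 7 := by
      rw [div_le_iff₀ (by linarith)]
      nlinarith [pow_pos h0 7]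
    refine le_trans (le_of_eq ?_) (h.trans h2)
    congr 1
    ring
  have hρP : Tendsto (fun ε : ℝ => (log (1 - ε) + (ε + ε ^ 2 / 2 + ε ^ 3 / 3 + ε ^ 4 / 4 + ε ^ 5 /
      5 + ε ^ 6 / 6)) / ε ^ 5) (𝓝[>] 0) (𝓝 0) := by
    have hb : Tendsto (fun ε : ℝ => 2 * ε ^ 2) (𝓝[>] 0) (𝓝 0) := by
      have hc : Continuous (fun ε : ℝ => 2 * ε ^ 2) := by fun_prop
      have := hc.tendsto 0
      simp only [ne_eq, OfNat.ofNat_ne_zero, not_false_eq_true, zero_pow, mul_zero] at this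
      exact tendsto_nhdsWithin_of_tendsto_nhds this
    refine squeeze_zero_norm' ?_ hb
    filter_upwards [Ioo_mem_nhdsGT (show (0:ℝ) < 1/2 by norm_num)] with ε hε
    rw [Real.norm_eq_abs, abs_div, abs_of_pos (pow_pos hε.1 _), div_le_iff₀ (pow_pos hε.1 _)]
    calc |log (1 - ε) + (ε + ε ^ 2 / 2 + ε ^ 3 / 3 + ε ^ 4 / 4 + ε ^ 5 / 5 + ε ^ 6 / 6)| ≤ 2 * ε ^
        7 := hρ_bound ε hε.1 hε.2
      _ = 2 * ε ^ 2 * ε ^ 5 := by ring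
  have hM : Tendsto (fun ε : ℝ => (((2354/675 : ℝ) * ε ^ 5 + (-254/135 : ℝ) * ε ^ 6 + (-13/27 : ℝ)
      * ε ^ 7 + (-94/135 : ℝ) * ε ^ 8 + (49/135 : ℝ) * ε ^ 9 + (-64/675 : ℝ) * ε ^ 10 + (-94/135 :
      ℝ) * ε ^ 11)
          + (log (1 - ε) + (ε + ε ^ 2 / 2 + ε ^ 3 / 3 + ε ^ 4 / 4 + ε ^ 5 / 5 + ε ^ 6 / 6)) *
              ((16/45 : ℝ) + (-16/9 : ℝ) * ε + (28/9 : ℝ) * ε ^ 2 + (-14/9 : ℝ) * ε ^ 3 + (-20/9 :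
              ℝ) * ε ^ 4 + (94/45 : ℝ) * ε ^ 5))) (𝓝[>] 0) (𝓝 (0 : ℝ)) := by
    have hc : ContinuousAt (fun ε : ℝ => (((2354/675 : ℝ) * ε ^ 5 + (-254/135 : ℝ) * ε ^ 6 +
        (-13/27 : ℝ) * ε ^ 7 + (-94/135 : ℝ) * ε ^ 8 + (49/135 : ℝ) * ε ^ 9 + (-64/675 : ℝ) * ε ^
        10 + (-94/135 : ℝ) * ε ^ 11)
          + (log (1 - ε) + (ε + ε ^ 2 / 2 + ε ^ 3 / 3 + ε ^ 4 / 4 + ε ^ 5 / 5 + ε ^ 6 / 6)) *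
              ((16/45 : ℝ) + (-16/9 : ℝ) * ε + (28/9 : ℝ) * ε ^ 2 + (-14/9 : ℝ) * ε ^ 3 + (-20/9 :
              ℝ) * ε ^ 4 + (94/45 : ℝ) * ε ^ 5))) 0 := by
      have hl : ContinuousAt (fun ε : ℝ => log (1 - ε)) 0 :=
        (continuousAt_const.sub continuousAt_id).log (by norm_num)
      fun_prop (disch := norm_num)
    convert tendsto_nhdsWithin_of_tendsto_nhds hc.tendsto using 2
    norm_num
  have hP : Tendsto (fun ε : ℝ => ε * (((-8/45 : ℝ) + (49/135 : ℝ) * ε + (34/135 : ℝ) * ε ^ 2 +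
      (83/405 : ℝ) * ε ^ 3 + (6551/40500 : ℝ) * ε ^ 4 + (2093/16200 : ℝ) * ε ^ 5 + (181/300 : ℝ) *
      ε ^ 6 + (1373/5400 : ℝ) * ε ^ 7)
          + ((101/675 : ℝ) * ε ^ 8 + (671/10125 : ℝ) * ε ^ 9 + (157/2025 : ℝ) * ε ^ 10 + (47/810 :
              ℝ) * ε ^ 11))) (𝓝[>] 0) (𝓝 0) := by
    have hc : Continuous (fun ε : ℝ => ε * (((-8/45 : ℝ) + (49/135 : ℝ) * ε + (34/135 : ℝ) * ε ^ 2
        + (83/405 : ℝ) * ε ^ 3 + (6551/40500 : ℝ) * ε ^ 4 + (2093/16200 : ℝ) * ε ^ 5 + (181/300 :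
        ℝ) * ε ^ 6 + (1373/5400 : ℝ) * ε ^ 7)
          + ((101/675 : ℝ) * ε ^ 8 + (671/10125 : ℝ) * ε ^ 9 + (157/2025 : ℝ) * ε ^ 10 + (47/810 :
              ℝ) * ε ^ 11))) := by fun_prop
    convert tendsto_nhdsWithin_of_tendsto_nhds (hc.tendsto 0) using 2
    norm_num
  have hmain := (tendsto_const_nhds (x := ((-347/162 : ℝ) : ℝ))).add (hP.add (hρP.mul hM))
  simp only [add_zero, zero_mul] at hmain
  refine hmain.congr' ?_
  filter_upwards [self_mem_nhdsWithin] with ε hε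
  have hε0 : ε ≠ 0 := ne_of_gt hε
  rw [elem_pow2_identity hε0 (log (1 - ε))]
  ring

/-! ## Stage 5: `ε → 0⁺` and the values of the kept masters -/

/-- `(1−x)K(x)^2` (closed kernel) is integrable on `[0,1]`: bounded by `1` on `(0,1/2]`
(kernel bounds `0 ≤ K ≤ x²/(15(1−x))`), and a finite sum of integrable masters on `[1/2,1]`.
[folklore] -/
theorem intervalIntegrable_closedKernel_pow2 :
    IntervalIntegrable (fun x : ℝ => (1 - x) * (4 / (3 * x ^ 2) - 4 / (3 * x) - 5 / 9 + (x ^ 3 - 6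
        * x + 4) / (3 * x ^ 3) * log (1 - x)) ^ 2) volume 0 1 := by
  have hmeas : Measurable (fun x : ℝ => (1 - x) * (4 / (3 * x ^ 2) - 4 / (3 * x) - 5 / 9 + (x ^ 3 -
      6 * x + 4) / (3 * x ^ 3) * log (1 - x)) ^ 2) := by
    fun_prop
  -- [0, 1/2]: bounded by 1
  have h1 : IntervalIntegrable (fun x : ℝ => (1 - x) * (4 / (3 * x ^ 2) - 4 / (3 * x) - 5 / 9 + (x
      ^ 3 - 6 * x + 4) / (3 * x ^ 3) * log (1 - x)) ^ 2) volume 0 (1/2) := by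
    refine (intervalIntegrable_const (c := (1:ℝ))).mono_fun' hmeas.aestronglyMeasurable ?_
    rw [uIoc_of_le (by norm_num : (0:ℝ) ≤ 1/2)]
    refine (ae_restrict_mem measurableSet_Ioc).mono fun x hx => ?_
    have hx0 : 0 < x := hx.1
    have hx1 : x < 1 := by linarith [hx.2]
    simp only
    rw [← neg_piOneLoop_sX_eq hx0 hx1]
    have hb := neg_piOneLoop_sX_bounds hx0.le hx1
    have hK1 : -piOneLoop (sX x) ≤ 1 := by
      refine hb.2.trans ?_
      rw [div_le_one (by nlinarith)]
      nlinarith [hx.2]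
    rw [Real.norm_eq_abs, abs_of_nonneg (by
      have := hb.1; positivity)]
    calc (1 - x) * (-piOneLoop (sX x)) ^ 2 ≤ 1 * 1 :=
          mul_le_mul (by linarith) (pow_le_one₀ hb.1 hK1) (pow_nonneg hb.1 _) zero_le_one
      _ = 1 := by norm_num
  -- [1/2, 1]: the expansion, termwise integrable
  have hI : ∀ (m : ℤ) (j : ℕ), IntervalIntegrable (fun x : ℝ => x ^ m * log (1 - x) ^ j) volume
      (1/2) 1 :=
    fun m j => intervalIntegrable_zpow_mul_log_one_sub_pow m j (by norm_num) (by norm_num)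
  have h2 : IntervalIntegrable (fun x : ℝ => (1 - x) * (4 / (3 * x ^ 2) - 4 / (3 * x) - 5 / 9 + (x
      ^ 3 - 6 * x + 4) / (3 * x ^ 3) * log (1 - x)) ^ 2) volume (1/2) 1 := by
    have hs : IntervalIntegrable (fun x : ℝ => ∑ i : Fin 21, (![(-25/81 : ℝ), (-95/81 : ℝ), (32/27
        : ℝ), (104/27 : ℝ), (-16/3 : ℝ), (16/9 : ℝ), (10/27 : ℝ), (14/27 : ℝ), (-4 : ℝ), (-20/27 :
        ℝ), (344/27 : ℝ), (-112/9 : ℝ), (32/9 : ℝ), (-1/9 : ℝ), (1/9 : ℝ), (4/3 : ℝ), (-20/9 : ℝ),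
        (-28/9 : ℝ), (28/3 : ℝ), (-64/9 : ℝ), (16/9 : ℝ)] i : ℝ)
        * (x ^ (-(![(-1 : ℤ), (0 : ℤ), (1 : ℤ), (2 : ℤ), (3 : ℤ), (4 : ℤ), (-1 : ℤ), (0 : ℤ), (1 :
            ℤ), (2 : ℤ), (3 : ℤ), (4 : ℤ), (5 : ℤ), (-1 : ℤ), (0 : ℤ), (1 : ℤ), (2 : ℤ), (3 : ℤ),
            (4 : ℤ), (5 : ℤ), (6 : ℤ)] i)) * log (1 - x) ^ (![(0 : ℕ), (0 : ℕ), (0 : ℕ), (0 : ℕ),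
            (0 : ℕ), (0 : ℕ), (1 : ℕ), (1 : ℕ), (1 : ℕ), (1 : ℕ), (1 : ℕ), (1 : ℕ), (1 : ℕ), (2 :
            ℕ), (2 : ℕ), (2 : ℕ), (2 : ℕ), (2 : ℕ), (2 : ℕ), (2 : ℕ), (2 : ℕ)] i))) volume (1/2) 1
            := by
      have := IntervalIntegrable.sum (μ := volume) (a := (1/2:ℝ)) (b := 1) (Finset.univ : Finset
          (Fin 21))
        (f := fun (i : Fin 21) (x : ℝ) => (![(-25/81 : ℝ), (-95/81 : ℝ), (32/27 : ℝ), (104/27 : ℝ),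
            (-16/3 : ℝ), (16/9 : ℝ), (10/27 : ℝ), (14/27 : ℝ), (-4 : ℝ), (-20/27 : ℝ), (344/27 :
            ℝ), (-112/9 : ℝ), (32/9 : ℝ), (-1/9 : ℝ), (1/9 : ℝ), (4/3 : ℝ), (-20/9 : ℝ), (-28/9 :
            ℝ), (28/3 : ℝ), (-64/9 : ℝ), (16/9 : ℝ)] i : ℝ)
          * (x ^ (-(![(-1 : ℤ), (0 : ℤ), (1 : ℤ), (2 : ℤ), (3 : ℤ), (4 : ℤ), (-1 : ℤ), (0 : ℤ), (1
              : ℤ), (2 : ℤ), (3 : ℤ), (4 : ℤ), (5 : ℤ), (-1 : ℤ), (0 : ℤ), (1 : ℤ), (2 : ℤ), (3 :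
              ℤ), (4 : ℤ), (5 : ℤ), (6 : ℤ)] i)) * log (1 - x) ^ (![(0 : ℕ), (0 : ℕ), (0 : ℕ), (0 :
              ℕ), (0 : ℕ), (0 : ℕ), (1 : ℕ), (1 : ℕ), (1 : ℕ), (1 : ℕ), (1 : ℕ), (1 : ℕ), (1 : ℕ),
              (2 : ℕ), (2 : ℕ), (2 : ℕ), (2 : ℕ), (2 : ℕ), (2 : ℕ), (2 : ℕ), (2 : ℕ)] i))) (fun i _
              => (hI _ _).const_mul _)
      have e : (∑ i : Fin 21, fun (x : ℝ) => (![(-25/81 : ℝ), (-95/81 : ℝ), (32/27 : ℝ), (104/27 :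
          ℝ), (-16/3 : ℝ), (16/9 : ℝ), (10/27 : ℝ), (14/27 : ℝ), (-4 : ℝ), (-20/27 : ℝ), (344/27 :
          ℝ), (-112/9 : ℝ), (32/9 : ℝ), (-1/9 : ℝ), (1/9 : ℝ), (4/3 : ℝ), (-20/9 : ℝ), (-28/9 : ℝ),
          (28/3 : ℝ), (-64/9 : ℝ), (16/9 : ℝ)] i : ℝ)
          * (x ^ (-(![(-1 : ℤ), (0 : ℤ), (1 : ℤ), (2 : ℤ), (3 : ℤ), (4 : ℤ), (-1 : ℤ), (0 : ℤ), (1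
              : ℤ), (2 : ℤ), (3 : ℤ), (4 : ℤ), (5 : ℤ), (-1 : ℤ), (0 : ℤ), (1 : ℤ), (2 : ℤ), (3 :
              ℤ), (4 : ℤ), (5 : ℤ), (6 : ℤ)] i)) * log (1 - x) ^ (![(0 : ℕ), (0 : ℕ), (0 : ℕ), (0 :
              ℕ), (0 : ℕ), (0 : ℕ), (1 : ℕ), (1 : ℕ), (1 : ℕ), (1 : ℕ), (1 : ℕ), (1 : ℕ), (1 : ℕ),
              (2 : ℕ), (2 : ℕ), (2 : ℕ), (2 : ℕ), (2 : ℕ), (2 : ℕ), (2 : ℕ), (2 : ℕ)] i)))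
          = fun x : ℝ => ∑ i : Fin 21, (![(-25/81 : ℝ), (-95/81 : ℝ), (32/27 : ℝ), (104/27 : ℝ),
              (-16/3 : ℝ), (16/9 : ℝ), (10/27 : ℝ), (14/27 : ℝ), (-4 : ℝ), (-20/27 : ℝ), (344/27 :
              ℝ), (-112/9 : ℝ), (32/9 : ℝ), (-1/9 : ℝ), (1/9 : ℝ), (4/3 : ℝ), (-20/9 : ℝ), (-28/9 :
              ℝ), (28/3 : ℝ), (-64/9 : ℝ), (16/9 : ℝ)] i : ℝ)
            * (x ^ (-(![(-1 : ℤ), (0 : ℤ), (1 : ℤ), (2 : ℤ), (3 : ℤ), (4 : ℤ), (-1 : ℤ), (0 : ℤ),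
                (1 : ℤ), (2 : ℤ), (3 : ℤ), (4 : ℤ), (5 : ℤ), (-1 : ℤ), (0 : ℤ), (1 : ℤ), (2 : ℤ),
                (3 : ℤ), (4 : ℤ), (5 : ℤ), (6 : ℤ)] i)) * log (1 - x) ^ (![(0 : ℕ), (0 : ℕ), (0 :
                ℕ), (0 : ℕ), (0 : ℕ), (0 : ℕ), (1 : ℕ), (1 : ℕ), (1 : ℕ), (1 : ℕ), (1 : ℕ), (1 :
                ℕ), (1 : ℕ), (2 : ℕ), (2 : ℕ), (2 : ℕ), (2 : ℕ), (2 : ℕ), (2 : ℕ), (2 : ℕ), (2 :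
                ℕ)] i)) := by
        funext x; simp only [Finset.sum_apply]
      rw [e] at this; exact this
    refine hs.congr ?_
    rw [uIoc_of_le (by norm_num : (1/2:ℝ) ≤ 1)]
    intro x hx
    have hx0 : x ≠ 0 := by linarith [hx.1]
    simp only
    rw [closedKernel_pow2_expand hx0]
    simp only [Fin.sum_univ_succ, Fin.sum_univ_zero, Matrix.cons_val_zero, Matrix.cons_val_succ,
      Matrix.cons_val_fin_one]
    simp only [zpow_neg, zpow_ofNat, neg_neg, pow_zero, pow_one, mul_one, one_mul, neg_zero]
    ring
  exact h1.trans h2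

/-- integrability of a kept master on `[0,1]`. [folklore] -/
theorem kept2_0_integrable : IntervalIntegrable (fun x : ℝ => x * log (1 - x)) volume 0 1 :=
  (by simpa only [pow_one, id] using ((intervalIntegrable_log_one_sub_pow 1).continuousOn_mul
      continuous_id.continuousOn))

/-- integrability of a kept master on `[0,1]`. [folklore] -/
theorem kept2_1_integrable : IntervalIntegrable (fun x : ℝ => log (1 - x)) volume 0 1 :=
  (by simpa only [pow_one] using intervalIntegrable_log_one_sub_pow 1)

/-- integrability of a kept master on `[0,1]`. [folklore] -/
theorem kept2_2_integrable : IntervalIntegrable (fun x : ℝ => x⁻¹ * log (1 - x)) volume 0 1 :=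
  (by simpa only [pow_one] using intervalIntegrable_inv_mul_log_one_sub_pow 1 (by norm_num))

/-- integrability of a kept master on `[0,1]`. [folklore] -/
theorem kept2_3_integrable : IntervalIntegrable (fun x : ℝ => x * log (1 - x) ^ 2) volume 0 1 :=
  (by simpa only [id] using ((intervalIntegrable_log_one_sub_pow 2).continuousOn_mul
      continuous_id.continuousOn))

/-- integrability of a kept master on `[0,1]`. [folklore] -/
theorem kept2_4_integrable : IntervalIntegrable (fun x : ℝ => log (1 - x) ^ 2) volume 0 1 :=
  (intervalIntegrable_log_one_sub_pow 2)

/-- integrability of a kept master on `[0,1]`. [folklore] -/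
theorem kept2_5_integrable : IntervalIntegrable (fun x : ℝ => x⁻¹ * log (1 - x) ^ 2) volume 0 1 :=
  (intervalIntegrable_inv_mul_log_one_sub_pow 2 (by norm_num))

/-- **`vpChain 2 1` equals the printed closed form** (Route D: expansion into the masters
`∫ x^{−q} logᵏ(1−x)`, integration-by-parts recurrences, the log series at `x → 0`, and
`∫₀¹ logᵏ(1−x)/x = (−1)ᵏ k! ζ(k+1)`). -/
theorem vpChain_2_one_eq :
    vpChain 2 1 = (-347/162 : ℝ)
      + ((10/27 : ℝ) * (∫ x in (0:ℝ)..1, x * log (1 - x))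
        + (14/27 : ℝ) * (∫ x in (0:ℝ)..1, log (1 - x))
        + (8/45 : ℝ) * (∫ x in (0:ℝ)..1, x⁻¹ * log (1 - x))
        + (-1/9 : ℝ) * (∫ x in (0:ℝ)..1, x * log (1 - x) ^ 2)
        + (1/9 : ℝ) * (∫ x in (0:ℝ)..1, log (1 - x) ^ 2)
        + (4/3 : ℝ) * (∫ x in (0:ℝ)..1, x⁻¹ * log (1 - x) ^ 2)) := by
  have hf := intervalIntegrable_closedKernel_pow2
  have hL := tendsto_integral_left hf
  have hR := ((((((tendsto_elem_pow2).add
    ((tendsto_integral_left kept2_0_integrable).const_mul (10/27 : ℝ))).add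
    ((tendsto_integral_left kept2_1_integrable).const_mul (14/27 : ℝ))).add
    ((tendsto_integral_left kept2_2_integrable).const_mul (8/45 : ℝ))).add
    ((tendsto_integral_left kept2_3_integrable).const_mul (-1/9 : ℝ))).add
    ((tendsto_integral_left kept2_4_integrable).const_mul (1/9 : ℝ))).add
    ((tendsto_integral_left kept2_5_integrable).const_mul (4/3 : ℝ))
  have heq : ∀ᶠ ε in 𝓝[>] (0:ℝ), (fun ε => ∫ x in ε..1, (1 - x) * (4 / (3 * x ^ 2) - 4 / (3 * x) -
      5 / 9 + (x ^ 3 - 6 * x + 4) / (3 * x ^ 3) * log (1 - x)) ^ 2) ε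
      = (fun ε => ((-311/162 : ℝ)
        + (16/45 : ℝ) * ((ε ^ 5)⁻¹ * log (1 - ε) ^ 2)
        + (32/45 : ℝ) * ((ε ^ 4)⁻¹ * log (1 - ε))
        + (-16/9 : ℝ) * ((ε ^ 4)⁻¹ * log (1 - ε) ^ 2)
        + (16/45 : ℝ) * ((ε ^ 3)⁻¹)
        + (-16/5 : ℝ) * ((ε ^ 3)⁻¹ * log (1 - ε))
        + (28/9 : ℝ) * ((ε ^ 3)⁻¹ * log (1 - ε) ^ 2)
        + (-64/45 : ℝ) * ((ε ^ 2)⁻¹)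
        + (632/135 : ℝ) * ((ε ^ 2)⁻¹ * log (1 - ε))
        + (-14/9 : ℝ) * ((ε ^ 2)⁻¹ * log (1 - ε) ^ 2)
        + (224/135 : ℝ) * (ε⁻¹)
        + (-136/135 : ℝ) * (ε⁻¹ * log (1 - ε))
        + (-20/9 : ℝ) * (ε⁻¹ * log (1 - ε) ^ 2)
        + (-32/27 : ℝ) * (log (1 - ε))
        + (94/45 : ℝ) * (log (1 - ε) ^ 2)
        + (95/81 : ℝ) * (ε)
        + (25/162 : ℝ) * (ε ^ 2))
      + (10/27 : ℝ) * (∫ x in ε..1, x * log (1 - x))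
      + (14/27 : ℝ) * (∫ x in ε..1, log (1 - x))
      + (8/45 : ℝ) * (∫ x in ε..1, x⁻¹ * log (1 - x))
      + (-1/9 : ℝ) * (∫ x in ε..1, x * log (1 - x) ^ 2)
      + (1/9 : ℝ) * (∫ x in ε..1, log (1 - x) ^ 2)
      + (4/3 : ℝ) * (∫ x in ε..1, x⁻¹ * log (1 - x) ^ 2)) ε := by
    filter_upwards [Ioo_mem_nhdsGT zero_lt_one] with ε hε
    exact integral_closedKernel_pow2_reduced hε.1 hε.2
  have hlim := tendsto_nhds_unique (hL.congr' heq) hR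
  rw [vpChain_one_eq_integral_closedKernel, hlim]
  ring

/-- **The sixth-order double bubble from the dispersion integral.** The equal-mass
two-insertion coefficient (3.153) of Jegerlehner's sequential-insertion representation,
`∫₀¹ (1−x) (−Π₂(s_x))² dx`, equals the printed closed form `−943/324 − 4π²/135 + (8/3)ζ(3)`
(Solovtsova–Lashkevich–Kaptari, eq. (lim1); orig. Mignaco–Remiddi 1969), typed as `vp6DoubleBubble`.
Our formalisation is elementary (Route D of the cell: masters `∫ x^{−q} logᵏ(1−x)`, by-parts
recurrences, the log series at `0`, `∫₀¹ logᵏ(1−x)/x = (−1)ᵏ k! ζ(k+1)`); the published derivations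
use dispersion / Mellin–Barnes representations.
[cite: Jegerlehner2017, eq. (3.153); SolovtsovaLashkevichKaptari2022, eq. (lim1)] -/
theorem vpChain_two_one : vpChain 2 1 = vp6DoubleBubble := by
  rw [vpChain_2_one_eq]
  have v0 : ∫ x in (0:ℝ)..1, x * log (1 - x) = -(3/4) := by
    have h := integral_id_mul_log_one_sub_pow 1
    simp only [pow_one] at h
    rw [h]; norm_num [Nat.factorial]
  have v1 : ∫ x in (0:ℝ)..1, log (1 - x) = -1 := by
    have h := integral_log_one_sub_pow 1
    simp only [pow_one] at h
    rw [h]; norm_num [Nat.factorial]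
  have v2 : ∫ x in (0:ℝ)..1, x⁻¹ * log (1 - x) = -(π ^ 2 / 6) := by
    have h := integral_inv_mul_log_one_sub_pow 1 le_rfl
    simp only [pow_one] at h
    rw [h, tsum_inv_succ_pow_eq_zeta 2 (by norm_num), zeta_two]; norm_num [Nat.factorial]
  have v3 : ∫ x in (0:ℝ)..1, x * log (1 - x) ^ 2 = 7/4 := by
    rw [integral_id_mul_log_one_sub_pow 2]; norm_num [Nat.factorial]
  have v4 : ∫ x in (0:ℝ)..1, log (1 - x) ^ 2 = 2 := by
    rw [integral_log_one_sub_pow 2]; norm_num [Nat.factorial]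
  have v5 : ∫ x in (0:ℝ)..1, x⁻¹ * log (1 - x) ^ 2 = 2 * zeta 3 := by
    rw [integral_inv_mul_log_one_sub_pow 2 (by norm_num), tsum_inv_succ_pow_eq_zeta 3 (by norm_num)]
    norm_num [Nat.factorial]
  rw [v0, v1, v2, v3, v4, v5, show vp6DoubleBubble = -943 / 324 - 4 * π ^ 2 / 135 + 8 / 3 * zeta 3
      from rfl]
  ring

end Summit.Ventures.QEDPrecision.BubbleChains

end
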